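import Summits.KontsevichZagierPeriods.KontsevichZagierPeriods.Theorems.LiouvilleUnfoldingAyoubPiLocalKernel
import Summits.KontsevichZagierPeriods.KontsevichZagierPeriods.Theorems.LiouvilleUnfoldingAyoubPiLocalKernelRing

/-!
# `AyoubPiLocalKernel` (stmt-KontsevichZagierPeriods-0541) — negative knowledge: what a kill must be

`¬ AyoubPiLocalKernel` (the crux is `KZ.PiLocalKernel`, Ayoub's Conjecture 7 for the four-move
calculus) holds iff there is an ADDITIVE INVARIANT `φ : KZ.FormalRep →+ A` of the four moves that
intertwines left multiplication by the disc `[π]` with an INJECTIVE additive self-map `u` of `A` and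
detects some formal combination of value `0` (`not_ayoubPiLocalKernel_iff_exists_shiftInvariant`).
`KZ.eval` with `u = (π • ·)` has every property but the last; no other such pair is known (every
additive move-invariant computed in the tree is `λ · eval` on the classes where it was computed; the
formal period group is divisible and torsion-free, so no `ℤ`-valued, finite or profinite invariant
exists at all — parent crux 2837, `LogKernelConjecture/Negative/Torsion.lean`). `→` uses the formal
period ring localised at the class of the disc (`Localization.Away`, `IsLocalization.map_eq_zero_iff`);
`←` is soundness-style bookkeeping. A disproof of item 0541 is therefore the CONSTRUCTION of an exotic
"integral" on which the disc acts injectively — and simultaneously a disproof of Conjecture 1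
(`PiLocalKernelPosition.ayoubPiLocalKernel_of_summit`).
[cite: Ayoub2014, Def. 6 and Conj. 7] [cite: KontsevichZagierPeriods2001, §4.1]
-/

noncomputable section

open Literature.NumberTheory.Transcendental
open Literature.NumberTheory.Transcendental.KZ

namespace Summit.KontsevichZagierPeriods.LiouvilleUnfolding.AyoubPiLocalKernelNegative.KillShape

open Summit.KontsevichZagierPeriods.KontsevichZagierPeriods.Theses.LiouvilleUnfolding
  (AyoubPiLocalKernel)
open Summit.KontsevichZagierPeriods.LiouvilleUnfolding.PiLocalKernelPosition
  (ayoubPiLocalKernel_iff_piLocalKernel toFormalPeriod_iterate_piRep_mul)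

/-- An additive map intertwining `[π] * ·` with `u` intertwines the iterates. [folklore] -/
theorem map_iterate_piRep_mul {A : Type*} [AddCommGroup A] (φ : FormalRep →+ A) (u : A →+ A)
    (hshift : ∀ x : FormalRep, φ (of piRep * x) = u (φ x)) (N : ℕ) (x : FormalRep) :
    φ ((fun y => of piRep * y)^[N] x) = (⇑u)^[N] (φ x) := by
  induction N with
  | zero => rfl
  | succ N ih => rw [Function.iterate_succ_apply', Function.iterate_succ_apply', hshift, ih]

/-- **Kill shape for item 0541.** `¬ AyoubPiLocalKernel ↔` there exist an abelian group `A`, an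
additive `φ : FormalRep →+ A` vanishing on `KZ.relations`, an injective additive `u : A →+ A` with
`φ ([π] * x) = u (φ x)`, and a formal combination `c` with `eval c = 0`, `φ c ≠ 0`.
`←`: a certificate `[π]^N ⋆ c ∈ relations` gives `u^[N] (φ c) = 0`, contradicting injectivity.
`→`: `A := P[ϖ⁻¹]`, the formal period ring `P = FormalRep ⧸ relations` localised at the class `ϖ` of
the disc, `φ` the canonical map, `u := (ϖ • ·)` (a unit there); `φ c = 0` would give
`ϖ^N ⋆ c ∈ relations` (`IsLocalization.map_eq_zero_iff`). [folklore] -/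
theorem not_ayoubPiLocalKernel_iff_exists_shiftInvariant :
    ¬ AyoubPiLocalKernel ↔
      ∃ (A : Type) (_ : AddCommGroup A) (φ : FormalRep →+ A) (u : A →+ A),
        Function.Injective u ∧ (∀ x ∈ relations, φ x = 0) ∧
          (∀ x : FormalRep, φ (of piRep * x) = u (φ x)) ∧
            ∃ c : FormalRep, eval c = 0 ∧ φ c ≠ 0 := by
  rw [ayoubPiLocalKernel_iff_piLocalKernel]
  constructor
  · intro h
    unfold PiLocalKernel at h
    push Not at h
    obtain ⟨c, hc, hN⟩ := h
    set ϖ : FormalPeriodRing := toFormalPeriod (of piRep) with hϖ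
    have hunit : IsUnit (algebraMap FormalPeriodRing (Localization.Away ϖ) ϖ) :=
      IsLocalization.Away.algebraMap_isUnit ϖ
    refine ⟨Localization.Away ϖ, inferInstance,
      (algebraMap FormalPeriodRing (Localization.Away ϖ)).toAddMonoidHom.comp
        toFormalPeriod.toAddMonoidHom,
      AddMonoidHom.mulLeft (algebraMap FormalPeriodRing (Localization.Away ϖ) ϖ),
      hunit.mul_right_injective, fun x hx => ?_, fun x => ?_, c, hc, fun h0 => ?_⟩
    · change algebraMap FormalPeriodRing (Localization.Away ϖ) (toFormalPeriod x) = 0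
      rw [toFormalPeriod_eq_zero_iff.mpr hx, map_zero]
    · change algebraMap FormalPeriodRing (Localization.Away ϖ) (toFormalPeriod (of piRep * x)) =
        algebraMap FormalPeriodRing (Localization.Away ϖ) ϖ *
          algebraMap FormalPeriodRing (Localization.Away ϖ) (toFormalPeriod x)
      rw [map_mul, map_mul]
    · change algebraMap FormalPeriodRing (Localization.Away ϖ) (toFormalPeriod c) = 0 at h0
      rw [IsLocalization.map_eq_zero_iff (Submonoid.powers ϖ)] at h0
      obtain ⟨⟨m, N, rfl⟩, hm⟩ := h0
      apply hN N
      rw [← toFormalPeriod_eq_zero_iff, toFormalPeriod_iterate_piRep_mul]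
      exact hm
  · rintro ⟨A, _, φ, u, hu, hrel, hshift, c, hc, hφc⟩ h
    obtain ⟨N, hN⟩ := h c hc
    have h1 := hrel _ hN
    rw [map_iterate_piRep_mul φ u hshift] at h1
    have h2 : (⇑u)^[N] (φ c) = (⇑u)^[N] 0 := by rw [h1, iterate_map_zero]
    exact hφc (hu.iterate N h2)

/-- In particular **`KZ.eval` itself is not a kill**: it satisfies every clause of the kill shape
except detection (it vanishes on the kernel by definition) — recorded as the sanity instance of the
criterion with `u = (π • ·)`. [folklore] -/
theorem eval_is_shiftInvariant :
    (∀ x ∈ relations, eval x = 0) ∧ Function.Injective (AddMonoidHom.mulLeft Real.pi : ℝ →+ ℝ) ∧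
      ∀ x : FormalRep, eval (of piRep * x) = (AddMonoidHom.mulLeft Real.pi : ℝ →+ ℝ) (eval x) :=
  ⟨fun _ hx => relations_le_ker_eval_holds hx, mul_right_injective₀ Real.pi_ne_zero,
    fun x => by rw [AddMonoidHom.coe_mulLeft, eval_piRep_mul]⟩

end Summit.KontsevichZagierPeriods.LiouvilleUnfolding.AyoubPiLocalKernelNegative.KillShape

end
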